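import Summits.BirchSwinnertonDyer.BirchSwinnertonDyer.Theorems.KimAtThreeFineKatoValueEquivarianceLocal
import Summits.BirchSwinnertonDyer.BirchSwinnertonDyer.Theorems.KimAtThreeFineKatoValueEquivarianceStabAll
import Literature.NumberTheory.GaloisRepresentations.PadicAlgebraOfLocalField
import HarnessLib

/-!
# Galois bookkeeping for the PLACE CHANGE of the defined value datum: two completions `L_{w₀}`, `L_{w₁}`
# (`w₀, w₁ ∣ p`) of the level field `L = ℚ(ζ_m)` are identified by `(γ)_*` for ONE `γ ∈ Gal(L/ℚ)`,
# `γ • w₀ = w₁`, COMPATIBLE WITH THE CHOSEN CLOSURE EMBEDDINGS (crux `KatoKuriharaPortThreeShared`,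
# stmt-BirchSwinnertonDyer-19560; cell `bsd-addord`, seat w2-acc5 gen 7; route W2 `KimAtThreeKolyvagin`;
# `--supports 19560`, helper)

HONEST FRAMING.  TOOL theorems only (no definition, no named fact, no instance, no `sorry`); every `p`, `k`, `r`;
closes nothing; nothing is booked; BSD / 19560 are NOT proved by any of this.

WHY.  Kato's value datum is DEFINED in the kernel through ONE completion `L_{w₀}` (w2-acc5 gen 6 `katoLambda`,
`KimAtThreeFineKatoDefinedLambdaExpStarDefs`): `exp*_{w₀} ∘ loc^{tower}_{w₀}`, the tower being
`Γ_{L_{w₀}} → Γ_{ℚ_v} → Γ_ℚ` built from the chosen embeddings `absClosureEmbedding`.  For EVERY `w₀` that tower lands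
in the decomposition group of the ONE prime `𝔓₀ = adicCompletionPrime ℚ v` (`LevelFieldLocalization`), so the place
actually read does not move with `w₀`; comparing `katoLambda` at two places `w₀, w₁` therefore needs the
`ℚ_v`-isomorphism `L_{w₀} ≅ L_{w₁}` THROUGH WHICH THE EMBEDDINGS SEE THE TWO FIELDS.  This file produces it as
`(γ)_* = galAdicCompletionMap γ` for an element `γ ∈ Gal(L/ℚ)` with `γ • w₀ = w₁` (so that the semi-local algebra
`padicTensor_map_galois` applies), together with the transported restriction `s : Γ_{L_{w₁}} → Γ_{L_{w₀}}`:

* `smul_place_eq_of_absGaloisRestrict` — every `δ' ∈ Γ_{ℚ_v}` fixes every place `w ∣ p` of `L` through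
  `δ̃ = sigma m (χ_m (res δ'))` (`res δ' ∈ D_{𝔓₀}` fixes the place under `𝔓₀`; all places above `p` have the same
  stabiliser, `CyclotomicPlacesAbsGalois`).
* `exists_algEquiv_absEmbedding_galAdicCompletionMap` — **∃ `γ`, `γ • w₀ = w₁`, with
  `e_{w₁} ∘ (γ)_* = e_{w₀}`** (`e_w = absEmbedding ℚ_v L_w : L_w → \bar ℚ_v`).  Proof: start from any `γ₀` with
  `γ₀ • w₀ = w₁` (transitivity); `e_{w₁} ∘ (γ₀)_*` factors through `e_{w₀}` by an automorphism of the normal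
  extension `L_{w₀}/ℚ_v` (Mathlib `AlgHom.restrictNormal'`), which is `δ̃'_*` for some `δ' ∈ Γ_{ℚ_v}`
  (`absGaloisQuot_surjective`, `galAdicCompletionMap_sigma_eq_absGaloisQuot`); take `γ = γ₀ δ̃'⁻¹`.
* `absClosureEmbedding_eq_of_absEmbedding_galAdicCompletionMap` — the same compatibility in the form `hg` used by
  `KimAtThreeFineKatoExpStarGaloisTwo.expStarOmega_galois₂` (`ι_{w₀} y = x ⟹ ι_{w₁} y = (γ)_* x`).
* `exists_continuousMonoidHom_absGaloisRestrict_eq` — **∃ `s : Γ_{L_{w₁}} →ₜ* Γ_{L_{w₀}}` with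
  `res_{w₀} ∘ s = res_{w₁}`** (the two restriction images are the pointwise stabilisers of `e_{w₀}(L_{w₀}) =
  e_{w₁}(L_{w₁})`), and `absGaloisRestrictTower_eq_of_absGaloisRestrict_eq` (then the two towers to `Γ_ℚ` agree).

References: J. Neukirch, *Algebraic Number Theory* (1999) Ch. I §9, Ch. II §9 (9.6) [NeukirchANT1999];
J. W. S. Cassels, A. Fröhlich (1967) Ch. VII §1.1, Prop. 1.2 [CasselsFrohlichANT1967]; J. S. Milne, *Fields and Galois
Theory* (2022) Ch. 7 [MilneFT2022].
-/

noncomputable section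

-- the cell's Theorems namespace `Summit.BirchSwinnertonDyer.BirchSwinnertonDyer.…` repeats the summit name by design (D-0017)
set_option linter.dupNamespace false

open scoped Classical NumberField Pointwise
open Field NumberField IsDedekindDomain Polynomial
open Literature.NumberTheory.GaloisRepresentations
  Literature.NumberTheory.EllipticCurves.Kato2004.EulerSystemValues
open Literature.NumberTheory.AdelicBaseChange Literature.NumberTheory.Automorphic
open Summit.BirchSwinnertonDyer.BirchSwinnertonDyer.Theorems.KimAtThreeFineKatoValueEquivarianceLocal
open Summit.BirchSwinnertonDyer.BirchSwinnertonDyer.Theorems.KimAtThreeFineKatoValueEquivarianceStabAll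

namespace Summit.BirchSwinnertonDyer.BirchSwinnertonDyer.Theorems.KimAtThreeFineKatoPlaceChangeGalois

variable (p : ℕ) [hp : Fact p.Prime] (k : ℕ) (r : Finset (HeightOneSpectrum (𝓞 ℚ)))

/-! ## §1. Every `δ' ∈ Γ_{ℚ_v}` fixes every place above `p` -/

set_option backward.isDefEq.respectTransparency false in
/-- **Every `δ' ∈ Γ_{ℚ_v}` fixes every place `w ∣ p` of `L = ℚ(ζ_m)`** through `δ̃ = sigma m (χ_m (res δ'))`:
`res δ' ∈ D_{𝔓₀}` (`decompositionSubgroup_adicCompletionPrime_eq_range`) fixes `𝔓₀`, hence the place of `L` under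
`ι_* 𝔓₀` (`CyclotomicPlacesAbsGalois.under_comap_smul`), and all places above `p` have the same stabiliser
(`smul_place_eq_iff_of_under_eq`). [cite: NeukirchANT1999, Ch. I §9 (9.1)–(9.3) and Ch. II §9 Prop. (9.6)] -/
theorem smul_place_eq_of_absGaloisRestrict
    (w₀ : ((Rat.HeightOneSpectrum.primesEquiv (R := 𝓞 ℚ)).symm ⟨p, Fact.out⟩).Extension
      (𝓞 (CyclotomicField (cycLevel p k r) ℚ)))
    (δ' : absoluteGaloisGroup (((Rat.HeightOneSpectrum.primesEquiv (R := 𝓞 ℚ)).symm ⟨p, Fact.out⟩).adicCompletion ℚ)) :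
    sigma (cycLevel p k r) (modNCyclotomicCharacter ℚ (cycLevel p k r)
      (absGaloisRestrict ℚ (((Rat.HeightOneSpectrum.primesEquiv (R := 𝓞 ℚ)).symm ⟨p, Fact.out⟩).adicCompletion ℚ) δ')) •
        w₀.1 = w₀.1 := by
  let ιi : absIntegers (𝓞 (CyclotomicField (cycLevel p k r) ℚ)) (CyclotomicField (cycLevel p k r) ℚ) →+* absIntegers (𝓞 ℚ) ℚ :=
    (absIntegersEquiv ℚ (CyclotomicField (cycLevel p k r) ℚ)).symm
  have hcomap : ∀ I : Ideal (absIntegers (𝓞 ℚ) ℚ), (I.comap ιi).comap (absIntegersMap ℚ (CyclotomicField (cycLevel p k r) ℚ)) = I := fun I => by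
    rw [Ideal.comap_comap]
    have hc : ιi.comp (absIntegersMap ℚ (CyclotomicField (cycLevel p k r) ℚ)) = RingHom.id _ := by
      ext x
      exact congrArg Subtype.val ((absIntegersEquiv ℚ (CyclotomicField (cycLevel p k r) ℚ)).symm_apply_apply x)
    rw [hc, Ideal.comap_id]
  set δ := absGaloisRestrict ℚ (((Rat.HeightOneSpectrum.primesEquiv (R := 𝓞 ℚ)).symm ⟨p, Fact.out⟩).adicCompletion ℚ) δ' with hδdef
  -- `𝔓₀`, fixed by `δ = res δ' ∈ D_{𝔓₀}`
  have h𝔓₀ : adicCompletionPrime ℚ ((Rat.HeightOneSpectrum.primesEquiv (R := 𝓞 ℚ)).symm ⟨p, Fact.out⟩) ∈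
      ((Rat.HeightOneSpectrum.primesEquiv (R := 𝓞 ℚ)).symm ⟨p, Fact.out⟩).primesAbove :=
    adicCompletionPrime_mem_primesAbove ℚ ((Rat.HeightOneSpectrum.primesEquiv (R := 𝓞 ℚ)).symm ⟨p, Fact.out⟩)
  haveI : (adicCompletionPrime ℚ ((Rat.HeightOneSpectrum.primesEquiv (R := 𝓞 ℚ)).symm ⟨p, Fact.out⟩)).IsPrime := h𝔓₀.1
  have hfix : δ • adicCompletionPrime ℚ ((Rat.HeightOneSpectrum.primesEquiv (R := 𝓞 ℚ)).symm ⟨p, Fact.out⟩) =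
      adicCompletionPrime ℚ ((Rat.HeightOneSpectrum.primesEquiv (R := 𝓞 ℚ)).symm ⟨p, Fact.out⟩) := by
    have hmem : δ ∈ (absGaloisRestrict ℚ (((Rat.HeightOneSpectrum.primesEquiv (R := 𝓞 ℚ)).symm ⟨p, Fact.out⟩).adicCompletion ℚ)).toMonoidHom.range :=
      ⟨δ', rfl⟩
    rw [← decompositionSubgroup_adicCompletionPrime_eq_range] at hmem
    exact Ideal.mem_decompositionSubgroup_iff.mp hmem
  -- the place `w₁` of `L` under `ι_* 𝔓₀`
  haveI hQ₀ : ((adicCompletionPrime ℚ ((Rat.HeightOneSpectrum.primesEquiv (R := 𝓞 ℚ)).symm ⟨p, Fact.out⟩)).comap ιi).IsPrime :=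
    Ideal.comap_isPrime ιi _
  obtain ⟨w₁, hw₁v, -, hw₁eq⟩ :=
    exists_heightOneSpectrum_of_comap_absIntegersMap_mem_primesAbove (K := ℚ) (M := (CyclotomicField (cycLevel p k r) ℚ))
      (𝔔 := (adicCompletionPrime ℚ ((Rat.HeightOneSpectrum.primesEquiv (R := 𝓞 ℚ)).symm ⟨p, Fact.out⟩)).comap ιi) (by rw [hcomap]; exact h𝔓₀)
  -- `δ̃ • w₁ = w₁`
  have hunder := CyclotomicField.under_comap_smul (m := cycLevel p k r) δ
    (adicCompletionPrime ℚ ((Rat.HeightOneSpectrum.primesEquiv (R := 𝓞 ℚ)).symm ⟨p, Fact.out⟩))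
  rw [hfix] at hunder
  have hw₁fix : sigma (cycLevel p k r) (modNCyclotomicCharacter ℚ (cycLevel p k r) δ) • w₁ = w₁ := by
    apply HeightOneSpectrum.ext
    rw [HeightOneSpectrum.smul_asIdeal, hw₁eq]
    exact hunder.symm
  -- all places above `p` have the same stabiliser
  have hw₀w₁ : w₁.under (𝓞 ℚ) = w₀.1.under (𝓞 ℚ) := by
    rw [w₀.2]
    exact HeightOneSpectrum.ext hw₁v
  exact (CyclotomicField.smul_place_eq_iff_of_under_eq hw₀w₁ _).mp hw₁fix

/-! ## §2. The embedding-compatible `ℚ_v`-isomorphism `L_{w₀} ≅ L_{w₁}` is `(γ)_*` for one `γ`, `γ • w₀ = w₁` -/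

set_option backward.isDefEq.respectTransparency false in
/-- **∃ `γ ∈ Gal(L/ℚ)`, `γ • w₀ = w₁`, with `e_{w₁} ∘ (γ)_* = e_{w₀}`** (`e_w = absEmbedding ℚ_v L_w`, `(γ)_* =
galAdicCompletionMap γ`; module docstring, second bullet).
[cite: NeukirchANT1999, Ch. II §9 Prop. (9.6)] [cite: CasselsFrohlichANT1967, Ch. VII §1.1 and Prop. 1.2 (ii)]
[cite: MilneFT2022, Ch. 7] -/
theorem exists_algEquiv_absEmbedding_galAdicCompletionMap
    (w₀ w₁ : ((Rat.HeightOneSpectrum.primesEquiv (R := 𝓞 ℚ)).symm ⟨p, Fact.out⟩).Extension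
      (𝓞 (CyclotomicField (cycLevel p k r) ℚ))) :
    ∃ (γ : CyclotomicField (cycLevel p k r) ℚ ≃ₐ[ℚ] CyclotomicField (cycLevel p k r) ℚ) (hγ : γ • w₀.1 = w₁.1),
      ∀ x : w₀.1.adicCompletion (CyclotomicField (cycLevel p k r) ℚ),
        absEmbedding (((Rat.HeightOneSpectrum.primesEquiv (R := 𝓞 ℚ)).symm ⟨p, Fact.out⟩).adicCompletion ℚ)
            (w₁.1.adicCompletion (CyclotomicField (cycLevel p k r) ℚ)) (galAdicCompletionMap γ hγ x) =
          absEmbedding (((Rat.HeightOneSpectrum.primesEquiv (R := 𝓞 ℚ)).symm ⟨p, Fact.out⟩).adicCompletion ℚ)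
            (w₀.1.adicCompletion (CyclotomicField (cycLevel p k r) ℚ)) x := by
  haveI := IsCyclotomicExtension.isGalois {cycLevel p k r} ℚ (CyclotomicField (cycLevel p k r) ℚ)
  haveI hG₀ := isGalois_adicCompletion_cyclotomicField (cycLevel p k r)
    ((Rat.HeightOneSpectrum.primesEquiv (R := 𝓞 ℚ)).symm ⟨p, Fact.out⟩) w₀
  -- any `γ₀` with `γ₀ • w₀ = w₁`
  obtain ⟨γ₀, hγ₀⟩ := HeightOneSpectrum.exists_algEquiv_smul_eq ℚ
    (E := CyclotomicField (cycLevel p k r) ℚ) (w := w₀.1) (w' := w₁.1) (w₀.2.trans w₁.2.symm)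
  -- `(γ₀)_*` as a `ℚ_v`-algebra map and `e_{w₁} ∘ (γ₀)_*`
  let g₀ : w₀.1.adicCompletion (CyclotomicField (cycLevel p k r) ℚ) →ₐ[((Rat.HeightOneSpectrum.primesEquiv (R := 𝓞 ℚ)).symm ⟨p, Fact.out⟩).adicCompletion ℚ]
      w₁.1.adicCompletion (CyclotomicField (cycLevel p k r) ℚ) :=
    { (galAdicCompletionMap γ₀ hγ₀ :
          w₀.1.adicCompletion (CyclotomicField (cycLevel p k r) ℚ) →+*
            w₁.1.adicCompletion (CyclotomicField (cycLevel p k r) ℚ)) with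
      commutes' := fun s => galAdicCompletionMap_algebraMap_adicCompletion _ _ w₀ w₁ hγ₀ s }
  have hg₀ : ∀ x, g₀ x = galAdicCompletionMap γ₀ hγ₀ x := fun _ => rfl
  let φ : w₀.1.adicCompletion (CyclotomicField (cycLevel p k r) ℚ) →ₐ[((Rat.HeightOneSpectrum.primesEquiv (R := 𝓞 ℚ)).symm ⟨p, Fact.out⟩).adicCompletion ℚ]
      AlgebraicClosure (((Rat.HeightOneSpectrum.primesEquiv (R := 𝓞 ℚ)).symm ⟨p, Fact.out⟩).adicCompletion ℚ) :=
    (absEmbedding (((Rat.HeightOneSpectrum.primesEquiv (R := 𝓞 ℚ)).symm ⟨p, Fact.out⟩).adicCompletion ℚ)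
      (w₁.1.adicCompletion (CyclotomicField (cycLevel p k r) ℚ))).comp g₀
  -- factor `φ` through `e_{w₀}` by an automorphism `α` of the normal extension `L_{w₀}/ℚ_v`
  letI instA : Algebra (w₀.1.adicCompletion (CyclotomicField (cycLevel p k r) ℚ))
      (AlgebraicClosure (((Rat.HeightOneSpectrum.primesEquiv (R := 𝓞 ℚ)).symm ⟨p, Fact.out⟩).adicCompletion ℚ)) :=
    (absEmbedding (((Rat.HeightOneSpectrum.primesEquiv (R := 𝓞 ℚ)).symm ⟨p, Fact.out⟩).adicCompletion ℚ)
      (w₀.1.adicCompletion (CyclotomicField (cycLevel p k r) ℚ))).toRingHom.toAlgebra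
  haveI : IsScalarTower (((Rat.HeightOneSpectrum.primesEquiv (R := 𝓞 ℚ)).symm ⟨p, Fact.out⟩).adicCompletion ℚ)
      (w₀.1.adicCompletion (CyclotomicField (cycLevel p k r) ℚ))
      (AlgebraicClosure (((Rat.HeightOneSpectrum.primesEquiv (R := 𝓞 ℚ)).symm ⟨p, Fact.out⟩).adicCompletion ℚ)) :=
    IsScalarTower.of_algebraMap_eq fun x =>
      ((absEmbedding (((Rat.HeightOneSpectrum.primesEquiv (R := 𝓞 ℚ)).symm ⟨p, Fact.out⟩).adicCompletion ℚ)
        (w₀.1.adicCompletion (CyclotomicField (cycLevel p k r) ℚ))).commutes x).symm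
  let α : w₀.1.adicCompletion (CyclotomicField (cycLevel p k r) ℚ) ≃ₐ[((Rat.HeightOneSpectrum.primesEquiv (R := 𝓞 ℚ)).symm ⟨p, Fact.out⟩).adicCompletion ℚ]
      w₀.1.adicCompletion (CyclotomicField (cycLevel p k r) ℚ) :=
    φ.restrictNormal' (w₀.1.adicCompletion (CyclotomicField (cycLevel p k r) ℚ))
  have hα : ∀ x, absEmbedding (((Rat.HeightOneSpectrum.primesEquiv (R := 𝓞 ℚ)).symm ⟨p, Fact.out⟩).adicCompletion ℚ)
        (w₀.1.adicCompletion (CyclotomicField (cycLevel p k r) ℚ)) (α x) =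
      absEmbedding (((Rat.HeightOneSpectrum.primesEquiv (R := 𝓞 ℚ)).symm ⟨p, Fact.out⟩).adicCompletion ℚ)
        (w₁.1.adicCompletion (CyclotomicField (cycLevel p k r) ℚ)) (galAdicCompletionMap γ₀ hγ₀ x) := fun x => by
    have h := AlgHom.restrictNormal_commutes φ (w₀.1.adicCompletion (CyclotomicField (cycLevel p k r) ℚ)) x
    exact h
  -- `α = δ̃'_*` for some `δ' ∈ Γ_{ℚ_v}`
  obtain ⟨δ', hδ'⟩ := absGaloisQuot_surjective (((Rat.HeightOneSpectrum.primesEquiv (R := 𝓞 ℚ)).symm ⟨p, Fact.out⟩).adicCompletion ℚ)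
    (w₀.1.adicCompletion (CyclotomicField (cycLevel p k r) ℚ)) α
  have hδfix := smul_place_eq_of_absGaloisRestrict p k r w₀ δ'
  set δt := sigma (cycLevel p k r) (modNCyclotomicCharacter ℚ (cycLevel p k r)
    (absGaloisRestrict ℚ (((Rat.HeightOneSpectrum.primesEquiv (R := 𝓞 ℚ)).symm ⟨p, Fact.out⟩).adicCompletion ℚ) δ')) with hδt
  have hαt : ∀ x, α x = galAdicCompletionMap δt hδfix x := fun x => by
    rw [← hδ', galAdicCompletionMap_sigma_eq_absGaloisQuot p k r w₀ δ' hδfix x]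
  -- `γ := γ₀ δ̃'⁻¹`
  have hδinv : δt⁻¹ • w₀.1 = w₀.1 := inv_smul_eq_of_smul_eq hδfix
  have hγ : (γ₀ * δt⁻¹) • w₀.1 = w₁.1 := by rw [mul_smul, hδinv, hγ₀]
  refine ⟨γ₀ * δt⁻¹, hγ, fun x => ?_⟩
  rw [← galAdicCompletionMap_galAdicCompletionMap (CyclotomicField (cycLevel p k r) ℚ) δt⁻¹ γ₀ hδinv hγ₀ x, ← hα,
    hαt, galAdicCompletionMap_apply_inv]

set_option backward.isDefEq.respectTransparency false in
/-- **The closure-embedding compatibility `hg` of `expStarOmega_galois₂` for `g = (γ)_*`**: if `e_{w₁} ∘ (γ)_* = e_{w₀}`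
then `ι_{w₀} y = x ∈ L_{w₀} ⟹ ι_{w₁} y = (γ)_* x ∈ L_{w₁}` (`ι_w = absClosureEmbedding ℚ_v L_w`, `ι_w ∘ e_w = (L_w ⊆ \bar L_w)`).
[cite: MilneFT2022, Ch. 7] -/
theorem absClosureEmbedding_eq_of_absEmbedding_galAdicCompletionMap
    (w₀ w₁ : ((Rat.HeightOneSpectrum.primesEquiv (R := 𝓞 ℚ)).symm ⟨p, Fact.out⟩).Extension
      (𝓞 (CyclotomicField (cycLevel p k r) ℚ)))
    (γ : CyclotomicField (cycLevel p k r) ℚ ≃ₐ[ℚ] CyclotomicField (cycLevel p k r) ℚ) (hγ : γ • w₀.1 = w₁.1)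
    (hemb : ∀ x : w₀.1.adicCompletion (CyclotomicField (cycLevel p k r) ℚ),
      absEmbedding (((Rat.HeightOneSpectrum.primesEquiv (R := 𝓞 ℚ)).symm ⟨p, Fact.out⟩).adicCompletion ℚ)
          (w₁.1.adicCompletion (CyclotomicField (cycLevel p k r) ℚ)) (galAdicCompletionMap γ hγ x) =
        absEmbedding (((Rat.HeightOneSpectrum.primesEquiv (R := 𝓞 ℚ)).symm ⟨p, Fact.out⟩).adicCompletion ℚ)
          (w₀.1.adicCompletion (CyclotomicField (cycLevel p k r) ℚ)) x)
    (y : AlgebraicClosure (((Rat.HeightOneSpectrum.primesEquiv (R := 𝓞 ℚ)).symm ⟨p, Fact.out⟩).adicCompletion ℚ))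
    (x : w₀.1.adicCompletion (CyclotomicField (cycLevel p k r) ℚ))
    (hyx : absClosureEmbedding (((Rat.HeightOneSpectrum.primesEquiv (R := 𝓞 ℚ)).symm ⟨p, Fact.out⟩).adicCompletion ℚ)
        (w₀.1.adicCompletion (CyclotomicField (cycLevel p k r) ℚ)) y =
      algebraMap (w₀.1.adicCompletion (CyclotomicField (cycLevel p k r) ℚ))
        (AlgebraicClosure (w₀.1.adicCompletion (CyclotomicField (cycLevel p k r) ℚ))) x) :
    absClosureEmbedding (((Rat.HeightOneSpectrum.primesEquiv (R := 𝓞 ℚ)).symm ⟨p, Fact.out⟩).adicCompletion ℚ)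
        (w₁.1.adicCompletion (CyclotomicField (cycLevel p k r) ℚ)) y =
      algebraMap (w₁.1.adicCompletion (CyclotomicField (cycLevel p k r) ℚ))
        (AlgebraicClosure (w₁.1.adicCompletion (CyclotomicField (cycLevel p k r) ℚ))) (galAdicCompletionMap γ hγ x) := by
  have hy : y = absEmbedding (((Rat.HeightOneSpectrum.primesEquiv (R := 𝓞 ℚ)).symm ⟨p, Fact.out⟩).adicCompletion ℚ)
      (w₀.1.adicCompletion (CyclotomicField (cycLevel p k r) ℚ)) x := by
    apply (absClosureEmbedding (((Rat.HeightOneSpectrum.primesEquiv (R := 𝓞 ℚ)).symm ⟨p, Fact.out⟩).adicCompletion ℚ)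
      (w₀.1.adicCompletion (CyclotomicField (cycLevel p k r) ℚ))).injective
    exact hyx.trans (absClosureEmbedding_absEmbedding _ _ x).symm
  rw [hy, ← hemb x, absClosureEmbedding_absEmbedding]

/-! ## §3. The transported restriction `s : Γ_{L_{w₁}} → Γ_{L_{w₀}}`, `res_{w₀} ∘ s = res_{w₁}` -/

set_option backward.isDefEq.respectTransparency false in
/-- **∃ `s : Γ_{L_{w₁}} →ₜ* Γ_{L_{w₀}}` with `res_{w₀} (s τ) = res_{w₁} τ`** (module docstring, last bullet): the
images of the two restrictions are the pointwise stabilisers of `e_{w₀}(L_{w₀}) = e_{w₁}(L_{w₁})`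
(`mem_range_absGaloisRestrict_iff_smul_absEmbedding`, §2), `res_{w₀}` is a closed embedding, and the lift is a
continuous homomorphism. [cite: NeukirchANT1999, Ch. II §9 Prop. (9.6)] [cite: MilneFT2022, Ch. 7] -/
theorem exists_continuousMonoidHom_absGaloisRestrict_eq
    (w₀ w₁ : ((Rat.HeightOneSpectrum.primesEquiv (R := 𝓞 ℚ)).symm ⟨p, Fact.out⟩).Extension
      (𝓞 (CyclotomicField (cycLevel p k r) ℚ))) :
    ∃ s : absoluteGaloisGroup (w₁.1.adicCompletion (CyclotomicField (cycLevel p k r) ℚ)) →ₜ*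
        absoluteGaloisGroup (w₀.1.adicCompletion (CyclotomicField (cycLevel p k r) ℚ)),
      ∀ τ, absGaloisRestrict (((Rat.HeightOneSpectrum.primesEquiv (R := 𝓞 ℚ)).symm ⟨p, Fact.out⟩).adicCompletion ℚ)
            (w₀.1.adicCompletion (CyclotomicField (cycLevel p k r) ℚ)) (s τ) =
          absGaloisRestrict (((Rat.HeightOneSpectrum.primesEquiv (R := 𝓞 ℚ)).symm ⟨p, Fact.out⟩).adicCompletion ℚ)
            (w₁.1.adicCompletion (CyclotomicField (cycLevel p k r) ℚ)) τ := by
  haveI hG₀ := isGalois_adicCompletion_cyclotomicField (cycLevel p k r)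
    ((Rat.HeightOneSpectrum.primesEquiv (R := 𝓞 ℚ)).symm ⟨p, Fact.out⟩) w₀
  letI := LocalField.charZero_adicCompletion w₀.1
  obtain ⟨γ, hγ, hemb⟩ := exists_algEquiv_absEmbedding_galAdicCompletionMap p k r w₀ w₁
  -- every `res_{w₁} τ` fixes `e_{w₀}(L_{w₀})` pointwise, hence lies in the range of `res_{w₀}`
  have hmem : ∀ τ, absGaloisRestrict (((Rat.HeightOneSpectrum.primesEquiv (R := 𝓞 ℚ)).symm ⟨p, Fact.out⟩).adicCompletion ℚ)
        (w₁.1.adicCompletion (CyclotomicField (cycLevel p k r) ℚ)) τ ∈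
      (absGaloisRestrict (((Rat.HeightOneSpectrum.primesEquiv (R := 𝓞 ℚ)).symm ⟨p, Fact.out⟩).adicCompletion ℚ)
        (w₀.1.adicCompletion (CyclotomicField (cycLevel p k r) ℚ))).range := fun τ => by
    rw [mem_range_absGaloisRestrict_iff_smul_absEmbedding]
    intro x
    rw [← hemb x]
    exact absGaloisRestrict_smul_absEmbedding _ _ τ _
  choose sf hsf0 using hmem
  have hsf : ∀ τ, absGaloisRestrict (((Rat.HeightOneSpectrum.primesEquiv (R := 𝓞 ℚ)).symm ⟨p, Fact.out⟩).adicCompletion ℚ)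
        (w₀.1.adicCompletion (CyclotomicField (cycLevel p k r) ℚ)) (sf τ) =
      absGaloisRestrict (((Rat.HeightOneSpectrum.primesEquiv (R := 𝓞 ℚ)).symm ⟨p, Fact.out⟩).adicCompletion ℚ)
        (w₁.1.adicCompletion (CyclotomicField (cycLevel p k r) ℚ)) τ := fun τ => hsf0 τ
  have hinj := absGaloisRestrict_injective (((Rat.HeightOneSpectrum.primesEquiv (R := 𝓞 ℚ)).symm ⟨p, Fact.out⟩).adicCompletion ℚ)
    (w₀.1.adicCompletion (CyclotomicField (cycLevel p k r) ℚ))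
  let s₀ : absoluteGaloisGroup (w₁.1.adicCompletion (CyclotomicField (cycLevel p k r) ℚ)) →*
      absoluteGaloisGroup (w₀.1.adicCompletion (CyclotomicField (cycLevel p k r) ℚ)) :=
    { toFun := sf
      map_one' := hinj (by rw [hsf, map_one, map_one])
      map_mul' := fun a b => hinj (by rw [hsf, map_mul, map_mul, hsf, hsf]) }
  have hs₀ : ∀ τ, s₀ τ = sf τ := fun _ => rfl
  have hcont : Continuous s₀ := by
    rw [(isClosedEmbedding_absGaloisRestrict (((Rat.HeightOneSpectrum.primesEquiv (R := 𝓞 ℚ)).symm ⟨p, Fact.out⟩).adicCompletion ℚ)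
      (w₀.1.adicCompletion (CyclotomicField (cycLevel p k r) ℚ))).isEmbedding.continuous_iff]
    have : (absGaloisRestrict (((Rat.HeightOneSpectrum.primesEquiv (R := 𝓞 ℚ)).symm ⟨p, Fact.out⟩).adicCompletion ℚ)
        (w₀.1.adicCompletion (CyclotomicField (cycLevel p k r) ℚ))) ∘ s₀ =
        fun τ => absGaloisRestrict (((Rat.HeightOneSpectrum.primesEquiv (R := 𝓞 ℚ)).symm ⟨p, Fact.out⟩).adicCompletion ℚ)
          (w₁.1.adicCompletion (CyclotomicField (cycLevel p k r) ℚ)) τ := funext fun τ => (hsf τ)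
    rw [this]
    exact (absGaloisRestrict _ _).continuous
  exact ⟨⟨s₀, hcont⟩, fun τ => hsf τ⟩

/-- **Then the two towers to `Γ_ℚ` agree**: `res_{w₀} (s τ) = res_{w₁} τ ⟹ t_{w₀} (s τ) = t_{w₁} τ` for the composite
restrictions `t_w : Γ_{L_w} → Γ_{ℚ_v} → Γ_ℚ` (`absGaloisRestrictTower`; any intermediate `ℚ_v`-algebra spelling `E` of the
base completion). [cite: SerreGaloisCohomology1997, I §2.4 (compatible pairs)] -/
theorem absGaloisRestrictTower_eq_of_absGaloisRestrict_eq {E F F' : Type} [Field E] [Field F] [Field F']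
    [Algebra ℚ E] [Algebra E F] [Algebra E F']
    (s : absoluteGaloisGroup F' → absoluteGaloisGroup F)
    (hs : ∀ τ, absGaloisRestrict E F (s τ) = absGaloisRestrict E F' τ) (τ : absoluteGaloisGroup F') :
    absGaloisRestrictTower ℚ E F (s τ) = absGaloisRestrictTower ℚ E F' τ := by
  rw [absGaloisRestrictTower_apply, absGaloisRestrictTower_apply, hs]

end Summit.BirchSwinnertonDyer.BirchSwinnertonDyer.Theorems.KimAtThreeFineKatoPlaceChangeGalois

end
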